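import Summits.BirchSwinnertonDyer.BirchSwinnertonDyer.Theorems.ResidualThetaTransportAtTwoDefs
import Summits.BirchSwinnertonDyer.BirchSwinnertonDyer.Theorems.ResidualThetaTransportAtTwoResidualSignedLambdaLowerCMAtTwoRhoLayerPairingConj
import Summits.BirchSwinnertonDyer.BirchSwinnertonDyer.Theorems.ResidualThetaTransportAtTwoResidualSignedLambdaLowerCMAtTwoRhoLayerPairingCoeffSmul
import Summits.BirchSwinnertonDyer.BirchSwinnertonDyer.Theorems.ResidualThetaTransportAtTwoResidualSignedLambdaLowerCMAtTwoColemanPlusHomTwist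
import Summits.BirchSwinnertonDyer.BirchSwinnertonDyer.Theorems.ResidualThetaTransportAtTwoResidualSignedLambdaLowerCMAtTwoColemanSidePush
import HarnessLib

/-!
# Sketch (stub-ideation k4 · g20) — H8 of the S109 price list is a THEOREM about `π : OnePairPins` (kernel, 0 sorry):
# `𝒸 (r • x) = r • 𝒸 x` for every `r ∈ ℤ₂⟦X⟧` and every `x ∈ 𝐇¹` (k2-g18 PLAN 2 signature / k2-g19's binder `hX`, verbatim currency)

Crux `(R≥)ᵖ` `ResidualThetaCountLowerPureAtTwo` (stmt-BirchSwinnertonDyer-26074); stub `stub_cmLambdaLower` (= RSL_g,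
stmt-BirchSwinnertonDyer-22608; skeleton `Lines/bt26_lambda.lean` v7, 22608's line `onepair` v3d). STUB-PLAN rev 25.1 S109 prices the k2 lane's
`(i)`-half adapter; after k2-g19 (07:32Z) the open kernel residue is «H8 (M), H9-loc (M)»; k3-g19 (07:47Z) «strikes» H8 from the path to `he` by
running the landed finite-to-full lemma on `Λ_𝒪·z` — but its step (1) `LIN-X|_S := colTuple_locd₂_X_smul` still owes that lemma's TWIST hypothesis
`hcol : col (z' = z ∘ g⁻¹) → col z' = (1 + X)·col z` for the SAME generator `g` as `hg`/`hP2`, which is NOT a field of `OnePairPins`. This file pays it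
and closes H8 outright, assume-the-opposite style: each would-be obstruction to the `Λ`-linearity of `𝒸 = π.cvec` is named and discharged by a
landed lemma, and what is left is PROVED.

§1 `exists_col_twist` — the TWIST CLAUSE of the pinned plus Coleman map: `π.col (z ∘ gH⁻¹) = (1 + X) · π.col z` for the generator `gH` hidden in
   `π.hcol`, DERIVED from `π.hcol`'s 5th (congruences) and 6th (uniqueness) conjuncts by the landed orbit-sum identity
   `SignedColemanImage.plusCongr_precomp_inv` (`gH^{4^m}` fixes `dH(2m)` by `Sprung2012.pow_mul_smul_of_mem_localLayerPointsOfEmb`). Would-be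
   obstruction «the pins fix `col` only up to the involution `(1+X) ↦ (1+X)⁻¹` / an `ι`-semilinear variant» (k2-g18 PLAN 2, k2-g19 l. 70): void —
   the congruences are stated along `gH^j • dH`, so uniqueness forces `τ = id`.
§2 `cvec_X_smul` (the `X`-step for `π`: §1 + (P2) `ThetaTransport.pair_conjMap_of_toZModPow` on `π.hpair` + `π.hlocd₂`, fed to the landed LIN-X
   `ThetaTransport.colTuple_locd₂_X_smul`; would-be obstruction «`gH ≠ γ`» void: both are `κ`-top-generators, `conjMap_layerSubgroup_eq_of_isTopGenerator`
   is inside the landed lemma), `cvec_C_smul` (the constants step: landed LIN-C₀ `ThetaTransport.colTuple_locd₂_C_smul` with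
   `pair_padicInt_smul_of_toZModPow` on `π.hpair`), and **`cvec_smul` = H8** on ALL of `𝐇¹` (finite-to-full by the LANDED
   `ColemanSideInjective.apply_smul_eq_smul_of_X_of_C` (k3-g12 §8) at `A := ℤ₂`, `j := iwasawaToIwasawaO S`, `S := ⊤`; would-be obstruction «no topology
   on `𝐇¹`» void: the values are power series, `X`-adically separated — `ColemanSideInjective.eq_zero_of_forall_X_pow_smul`). Cited, not restated.
§3 H9-loc, TYPED (statements only, `Prop`-valued, nothing asserted): the values-side `2`-adic form `H9locValues` is the well-typed exact reading (with the
   derivation for the prover in the docstring); `H9cvec` = H9 in `𝒸`-currency. Assume-the-opposite verdict on the points-side canonical-lift reading: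
   false as an exact identity in `ℤ₂` (counter-schema `𝒪 = ℤ₂`, `a = 1 + 2^m` in the docstring); only its residues hold.

HONEST FRAMING: THEOREMS ONLY in §1–§2 (no `sorry`, no instance, no notation, no named fact, axioms = the standard three); §3 = two `def … : Prop`
statements for the next prover, not facts. Nothing here is proposed to `Theorems/`; BSD is NOT proved by any of this, nor is 26074 / 22608 closed.

References: [Kobayashi2003] Thm. 6.2 (6.13), §8 (8.20)–(8.23); [Kato2004Asterisque] §12.2 (p. 220), §13.8 (pp. 228–229); [Sprung2012] Def. 5.9,
Prop. 7.3; [PerrinRiou1994Invent] §3.6.1; [Lang1990] Ch. 5 §1, Ch. 6 §2.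
-/

set_option autoImplicit false
set_option linter.dupNamespace false

noncomputable section

namespace Summit.BirchSwinnertonDyer.BirchSwinnertonDyer.Cruxes.ResidualThetaCountLowerPureAtTwo.SideaK4G20

/-! ## §1–§2 RTT currency: the pins `π : OnePairPins` -/

section RTT

open scoped Classical
open Literature.NumberTheory.EllipticCurves Literature.NumberTheory.EllipticCurves.GreenbergSelmer
  Literature.NumberTheory.GaloisRepresentations NumberField IsDedekindDomain Field WeierstrassCurve
  Literature.NumberTheory.EllipticCurves.Kobayashi2003 Literature.NumberTheory.EllipticCurves.Sprung2012
  Literature.NumberTheory.EllipticCurves.CyclotomicLayer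
  Summit.BirchSwinnertonDyer.BirchSwinnertonDyer.Theorems

variable (S : Set (PadicAlgCl 2)) (W : WeierstrassCurve ℚ) [W.IsElliptic] (κ : ZpExtension ℚ 2) (γ : absoluteGaloisGroup ℚ)
  (S₀ : Finset (HeightOneSpectrum (𝓞 ℚ))) (n : ℕ) (ρ : FramedGaloisRep ℚ ↥(padicCoeffIntegers S) 2)
  (Θ : ∀ v : HeightOneSpectrum (𝓞 ℚ), ((2 : ℕ) : 𝓞 ℚ) ∈ v.asIdeal →
    (Cofree ρ ↥(padicCoeffField S) ≃+ (Fin n → ↥(W.geomPrimaryTorsion 2))))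
  (hΘ : ∀ v hv (δ : absoluteGaloisGroup (v.adicCompletion ℚ)) m i,
    Θ v hv (resGalOfEmb (closureEmb (K := ℚ) (v.adicCompletion ℚ)) δ • m) i =
      resGalOfEmb (closureEmb (K := ℚ) (v.adicCompletion ℚ)) δ • Θ v hv m i)
  (I : Kato2004.IwasawaH1DataCoeff (FramedGaloisRep.toGaloisRep ρ) 2 κ γ)
  (Sg : AddSubgroup (subgroupH1 κ.kerSubgroup (Cofree ρ ↥(padicCoeffField S)))) [Module ↥(padicCoeffIntegers S) ↥Sg]
  (π : OnePair.OnePairPins S W κ γ S₀ n ρ Θ hΘ I Sg)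

/-- **§1 · The twist clause from the pins.** For the generator `gH` of `π.hcol`: `col (z ∘ gH⁻¹) = (1 + X) · col z` for all functionals
`z` on the tower points (congruences ⇒ `(1+X)·col z` is a plus value of `z ∘ gH⁻¹` by `SignedColemanImage.plusCongr_precomp_inv` at the orbit
of `dH(2m)`, `gH^{4^m} dH(2m) = dH(2m)`; uniqueness pins it). [cite: Kobayashi2003, Thm. 6.2 (6.13), §8 (8.20)–(8.23)] [cite: Sprung2012, Prop. 7.3] -/
theorem exists_col_twist :
    ∃ g : absoluteGaloisGroup (π.v.adicCompletion ℚ),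
      κ.IsTopGenerator (resGalOfEmb (closureEmb (K := ℚ) (π.v.adicCompletion ℚ)) g) ∧
      ∀ z z' : ↥(localTowerPointsOfEmb κ (closureEmb (K := ℚ) (π.v.adicCompletion ℚ)) W) →+ ℤ_[2],
        (∀ a : ↥(localTowerPointsOfEmb κ (closureEmb (K := ℚ) (π.v.adicCompletion ℚ)) W),
          z' a = z ⟨g⁻¹ • (a : localPoints W (π.v.adicCompletion ℚ)), smul_mem_localTowerPointsOfEmb κ _ W g⁻¹ a.2⟩) →
        π.col z' = (1 + PowerSeries.X) * π.col z := by
  obtain ⟨gH, dH, hdA, hg, hd, -, -, hcong, hpin⟩ := π.hcol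
  refine ⟨gH, hg, fun z z' hz' => (hpin z' _ fun m => ?_).symm⟩
  have hfix : gH ^ 2 ^ (2 * m) • dH (2 * m) = dH (2 * m) := by
    simpa using pow_mul_smul_of_mem_localLayerPointsOfEmb κ (closureEmb (K := ℚ) (π.v.adicCompletion ℚ)) W hg (hd (2 * m)) 1
  have hω : (((cyclotomicOmega 2 (2 * m)).map (Int.castRingHom ℤ_[2]) : Polynomial ℤ_[2]) : PowerSeries ℤ_[2]) =
      (((Polynomial.X + 1) ^ 2 ^ (2 * m) - 1 : Polynomial ℤ_[2]) : PowerSeries ℤ_[2]) := by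
    rw [SignedColemanImage.map_cyclotomicOmega]
  rw [hω]
  exact SignedColemanImage.plusCongr_precomp_inv (localTowerPointsOfEmb κ (closureEmb (K := ℚ) (π.v.adicCompletion ℚ)) W)
    (fun σ a ha ↦ smul_mem_localTowerPointsOfEmb κ _ W σ ha) gH (pow_pos two_pos _) (dH (2 * m)) hfix (hdA (2 * m))
    z z' hz' _ (π.col z) (by have := hcong z m; rwa [hω] at this)

set_option maxHeartbeats 1600000 in
-- the tower / layer subtypes are large; the final `exact` unfolds `cvec` and the `LinearMap → AddMonoidHom` coercion
/-- **§2a · The `X`-step for `𝒸 = π.cvec`**: `𝒸 (X • x) = X • 𝒸 x` (landed LIN-X `ThetaTransport.colTuple_locd₂_X_smul` fed with §1, (P2) from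
`π.hpair` by `pair_conjMap_of_toZModPow`, and `π.hlocd₂`). [cite: Kato2004Asterisque, §12.2 (p. 220)] [cite: Kobayashi2003, Thm. 6.2 (6.13)] -/
theorem cvec_X_smul (hγ : κ.IsTopGenerator γ) (x : I.H) :
    π.cvec ((PowerSeries.X : PowerSeries ↥(padicCoeffIntegers S)) • x) = (PowerSeries.X : PowerSeries ℤ_[2]) • π.cvec x := by
  obtain ⟨g, hg, htw⟩ := exists_col_twist S W κ γ S₀ n ρ Θ hΘ I Sg π
  have hP2 := fun (m : ℕ) (y : H1 (FramedGaloisRep.toGaloisRep ρ) (κ.layerSubgroup m))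
      (Q : Fin n → localPoints W (π.v.adicCompletion ℚ))
      (hQ : ∀ i, Q i ∈ localLayerPointsOfEmb κ (closureEmb (K := ℚ) (π.v.adicCompletion ℚ)) W m) =>
    ThetaTransport.pair_conjMap_of_toZModPow S ρ W (Θ π.v π.hv) κ π.v (hΘ π.v π.hv) π.ePk π.hμPk π.hadd₁Pk π.hadd₂Pk π.hgalPk
      π.pair π.hpair m g y Q hQ
  have htw' : ∀ z z' : ↥(localTowerPointsOfEmb κ (closureEmb (K := ℚ) (π.v.adicCompletion ℚ)) W) →+ ℤ_[2],
      (∀ a : ↥(localTowerPointsOfEmb κ (closureEmb (K := ℚ) (π.v.adicCompletion ℚ)) W),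
        z' a = z ⟨g⁻¹ • (a : localPoints W (π.v.adicCompletion ℚ)), smul_mem_localTowerPointsOfEmb κ _ W g⁻¹ a.2⟩) →
      π.col.toAddMonoidHom z' = (1 + PowerSeries.X) * π.col.toAddMonoidHom z := fun z z' hz' => by
    simpa only [LinearMap.toAddMonoidHom_coe] using htw z z' hz'
  have h := ThetaTransport.colTuple_locd₂_X_smul I W π.v hγ hg hP2 π.hlocd₂ π.col.toAddMonoidHom htw' x
  funext i
  simpa only [LinearMap.toAddMonoidHom_coe, OnePair.OnePairPins.cvec_apply, Pi.smul_apply] using congr_fun h i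

set_option maxHeartbeats 1600000 in
-- as above
/-- **§2b · The constants step for `𝒸 = π.cvec`**: `𝒸 (C (ι c) • x) = c • 𝒸 x`, `ι = padicIntToCoeffIntegers S` (landed LIN-C₀
`ThetaTransport.colTuple_locd₂_C_smul` with `pair_padicInt_smul_of_toZModPow` on `π.hpair`). [cite: Kato2004Asterisque, §12.2, §13.8] -/
theorem cvec_C_smul (c : ℤ_[2]) (x : I.H) :
    π.cvec ((PowerSeries.C (padicIntToCoeffIntegers S c) : PowerSeries ↥(padicCoeffIntegers S)) • x) = c • π.cvec x := by
  have hPC := fun (m : ℕ) (y : H1 (FramedGaloisRep.toGaloisRep ρ) (κ.layerSubgroup m))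
      (Q : Fin n → ↥(localLayerPointsOfEmb κ (closureEmb (K := ℚ) (π.v.adicCompletion ℚ)) W m)) =>
    ThetaTransport.pair_padicInt_smul_of_toZModPow S ρ W π.ePk π.hμPk π.hadd₁Pk π.hadd₂Pk π.hgalPk (Θ π.v π.hv) κ π.v (hΘ π.v π.hv)
      π.pair π.hpair m c y Q
  exact ThetaTransport.colTuple_locd₂_C_smul I W π.v hPC π.hlocd₂ π.col x

/-- **§2c · H8 (k2-g18 PLAN 2 / k2-g19 `hX`, verbatim currency): `𝒸 (r • x) = r • 𝒸 x` for every `r ∈ ℤ₂⟦X⟧` and every `x ∈ 𝐇¹`**, `r` acting on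
Kato's `𝐇¹` through `iwasawaToIwasawaO S = PowerSeries.map ι`. §2a + §2b + finite-to-full by the LANDED `ColemanSideInjective.apply_smul_eq_smul_of_X_of_C`
(k3-g12 §8) at `A := ℤ₂`, `j := iwasawaToIwasawaO S`, `S := ⊤`, with `X`-adic separatedness `ColemanSideInjective.eq_zero_of_forall_X_pow_smul`
(cited by name, not restated). [cite: Kato2004Asterisque, §12.2 (p. 220)] [cite: Kobayashi2003, Thm. 6.2] [cite: Lang1990, Ch. 6 §2 (p. 111)] -/
theorem cvec_smul (hγ : κ.IsTopGenerator γ) (r : PowerSeries ℤ_[2]) (x : I.H) :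
    π.cvec (iwasawaToIwasawaO S r • x) = r • π.cvec x := by
  obtain ⟨c, hc⟩ : ∃ c : I.H →+ (Fin n → PowerSeries ℤ_[2]), ∀ y, c y = π.cvec y :=
    ⟨AddMonoidHom.mk' π.cvec fun y y' => funext fun i => by
      simp only [OnePair.OnePairPins.cvec_apply, map_add, AddMonoidHom.add_comp, Pi.add_apply], fun _ => rfl⟩
  have hX : ∀ y ∈ (⊤ : Submodule (IwasawaAlgebraO S) I.H),
      c (iwasawaToIwasawaO S PowerSeries.X • y) = (PowerSeries.X : PowerSeries ℤ_[2]) • c y := fun y _ => by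
    rw [hc, hc, show iwasawaToIwasawaO S PowerSeries.X = PowerSeries.X from PowerSeries.map_X _]
    exact cvec_X_smul S W κ γ S₀ n ρ Θ hΘ I Sg π hγ y
  have hC : ∀ (a : ℤ_[2]), ∀ y ∈ (⊤ : Submodule (IwasawaAlgebraO S) I.H),
      c (iwasawaToIwasawaO S (PowerSeries.C a) • y) = (PowerSeries.C a : PowerSeries ℤ_[2]) • c y := fun a y _ => by
    rw [hc, hc, show iwasawaToIwasawaO S (PowerSeries.C a) = PowerSeries.C (padicIntToCoeffIntegers S a) from PowerSeries.map_C _ _,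
      cvec_C_smul S W κ γ S₀ n ρ Θ hΘ I Sg π]
    funext i
    rw [Pi.smul_apply, Pi.smul_apply, smul_eq_mul, PowerSeries.smul_eq_C_mul]
  have h := ColemanSideInjective.apply_smul_eq_smul_of_X_of_C ColemanSideInjective.eq_zero_of_forall_X_pow_smul (iwasawaToIwasawaO S) c ⊤
    hX hC r x Submodule.mem_top
  rwa [hc, hc] at h

/-- **§2d · H8 in k2-g19's `trivialisation_linear` spelling** (`PowerSeries.map ι r • x`, `ι = padicIntToCoeffIntegers S`; definitionally §2c since
`iwasawaToIwasawaO S = PowerSeries.map ι`). [cite: Kato2004Asterisque, §12.2 (p. 220)] -/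
theorem cvec_map_smul (hγ : κ.IsTopGenerator γ) (r : PowerSeries ℤ_[2]) (x : I.H) :
    π.cvec (PowerSeries.map (padicIntToCoeffIntegers S) r • x) = r • π.cvec x :=
  cvec_smul S W κ γ S₀ n ρ Θ hΘ I Sg π hγ r x

/-- **§2e · `𝒸` as a `ℤ₂⟦X⟧`-LINEAR MAP `𝐇¹ →ₗ 𝚲ⁿ` along `iwasawaToIwasawaO S`** — packaged without any instance: an additive hom with the
semilinearity clause (T64: no `Algebra ℤ₂⟦X⟧ Λ_𝒪` instance is declared; the clause is the datum k2-g18 PLAN 1 / k3-g19 `price_of_parts` consume).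
[cite: Kato2004Asterisque, §12.2 (p. 220)] -/
theorem exists_addMonoidHom_cvec (hγ : κ.IsTopGenerator γ) :
    ∃ c : I.H →+ (Fin n → PowerSeries ℤ_[2]),
      (∀ x, c x = π.cvec x) ∧ ∀ (r : PowerSeries ℤ_[2]) (x : I.H), c (iwasawaToIwasawaO S r • x) = r • c x :=
  ⟨AddMonoidHom.mk' π.cvec fun y y' => funext fun i => by
      simp only [OnePair.OnePairPins.cvec_apply, map_add, AddMonoidHom.add_comp, Pi.add_apply],
    fun _ => rfl, fun r x => cvec_smul S W κ γ S₀ n ρ Θ hΘ I Sg π hγ r x⟩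

/-! ## §3 H9-loc — the well-typed readings (statements for the next prover; nothing asserted) -/

/-- **H9-loc, VALUES-side `2`-adic form** (the exact reading): constants `a ∈ 𝒪` move across THE pinned layer pairing as the `2`-adic Schur
matrix `Aρ a ∈ M_n(ℤ₂)` acting on the VALUES, `⟨a·y, Q⟩_m = Σ_{i,l} (Aρ a)_{il} · ⟨y, δ_i Q_l⟩_m` (`δ_i Q_l` = the tuple with `Q_l` in slot `i`), where
`Aρ` intertwines `Θ` on every finite level (`hA`: `Θ(a·t)_i = Σ_l (Aρ a)_{il} Θ(t)_l` on `A_ρ[2^k]`, the currency of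
`ThetaTransport.decomp_equivariant_addMonoidHom_pi_primary_eq_sum_nsmul` packaged by k2-g19's `exists_unique_matrix_toZModPow_eq`). Derivation for the
prover: `e_k` is `𝒪`-balanced (`e_k(a·s, t) = e_k(s, a·t)`, value formula `π.hePk`), so `⟨a·y, Q⟩ ≡ e_k(y_k ∪ a·Θ⁻¹κQ) = e_k(y_k ∪ Θ⁻¹((Aρ a)·κQ))
≡ Σ_{i,l} Ã_{il} ⟨y, δ_i Q_l⟩ (mod 2^k)` for any integer lift `Ã ≡ Aρ a`, and `k → ∞`. ASSUME-THE-OPPOSITE VERDICT on the points-side reading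
«`⟨a·y, Q⟩_m = ⟨y, C_m·Q⟩_m` EXACTLY, with the canonical integer lift `C_m = ((Aρ a) mod 2^m).val` acting on the points»: false in `ℤ₂` — for `𝒪 = ℤ₂`
(`Aρ a = a·1`), `a = 1 + 2^m` gives `C_m = 1` and `⟨y, C_m·Q⟩ − ⟨a·y, Q⟩ = −2^m·⟨y, Q⟩ ≠ 0` whenever `⟨y, Q⟩_m ≠ 0`; only the residues `mod 2^m` of
the points-side form hold (and suffice for nothing downstream — H9 needs the exact values-side form). Statement only; nothing asserted.
[cite: Kato2004Asterisque, §13.8 (pp. 228–229)] [cite: SerreInventiones1972, §1.11 Prop. 12] -/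
def H9locValues : Prop :=
  ∀ (Aρ : ↥(padicCoeffIntegers S) →+* Matrix (Fin n) (Fin n) ℤ_[2]),
    (∀ (a : ↥(padicCoeffIntegers S)) (k : ℕ) (t : Cofree ρ ↥(padicCoeffField S)) (i : Fin n),
      (2 ^ k : ℕ) • t = 0 →
        Θ π.v π.hv (a • t) i = ∑ l, (PadicInt.toZModPow k (Aρ a i l)).val • Θ π.v π.hv t l) →
    ∀ (a : ↥(padicCoeffIntegers S)) (m : ℕ) (y : H1 (FramedGaloisRep.toGaloisRep ρ) (κ.layerSubgroup m))
      (Q : Fin n → ↥(localLayerPointsOfEmb κ (closureEmb (K := ℚ) (π.v.adicCompletion ℚ)) W m)),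
      π.pair m (a • y) Q = ∑ i, ∑ l, Aρ a i l * π.pair m y (Pi.single i (Q l))

/-- **H9 in `𝒸`-currency from H9-loc** (k2-g18's H9 signature up to the index transpose): what `H9locValues` gives after `π.hlocd₂`,
`IwasawaH1DataCoeff.proj_C_smul` and the `ℤ₂`-linearity of `π.col` — stated, for the next prover. [cite: Kato2004Asterisque, §13.8] -/
def H9cvec : Prop :=
  ∃ Aρ : ↥(padicCoeffIntegers S) →+* Matrix (Fin n) (Fin n) ℤ_[2],
    ∀ (a : ↥(padicCoeffIntegers S)) (x : I.H) (i : Fin n),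
      π.cvec ((PowerSeries.C a : PowerSeries ↥(padicCoeffIntegers S)) • x) i = ∑ j, PowerSeries.C (Aρ a j i) * π.cvec x j

end RTT

end Summit.BirchSwinnertonDyer.BirchSwinnertonDyer.Cruxes.ResidualThetaCountLowerPureAtTwo.SideaK4G20

end
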